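import Summits.CriticalPhenomena.SAWScalingLimit.Theorems.SAWTotalPositivityCriticalBubbleBoundJoinSummable
import Summits.CriticalPhenomena.SAWScalingLimit.Theorems.SAWTotalPositivityCriticalBubbleBoundJoinRooted

/-!
# Moment corollary of the join-mass block decay
(crux `SAWTotalPositivity.CriticalBubbleBound`, stmt-CriticalPhenomena-7117; line `docking-census-joining`,
registered stub `tsum_rpow_cterm_ne_top_of_blockDecay` of the join-mass programme, lead prover c6)

If the shifted class blocks satisfy `R'_i ≤ C_s 2^{s i}` for every `s > -1/2` (the output of the
join-mass bootstrap), then the class moment series `Σ_n (n+1)^t · cterm n` is FINITE for every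
`t < 1/2`: the moment ladder of the Disproof (§25) — `M_t = Σ_N N^t q_N x_c^N`, with the crux at the
rung `t = 1` — becomes finite up to (but excluding) the rung `t = 1/2` (Madras 1991 / Madras–Slade
Cor. 8.1.6 give only `t < -1/2`). Pure bookkeeping on top of `sum_block_cterm_le` and the generic
regrouping `tsum_ofReal_ne_top_of_blockMass_le`. [cite: Hammond2015SAPJoining, Theorem 1.3 (averaged form)]
-/

noncomputable section

open Literature.Probability.LatticeModels
open Literature.Probability.RandomPlanarGeometry Literature.Probability.RandomPlanarGeometry.SAW
open scoped BigOperators ENNReal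
open Summit.CriticalPhenomena.SAWScalingLimit.Theorems.CriticalBubbleBound.Negative (e₀)
open Summit.CriticalPhenomena.SAWScalingLimit.Theorems.CriticalBubbleBound.Docking

namespace Summit.CriticalPhenomena.SAWScalingLimit.Theorems.CriticalBubbleBound.Join

/-- On the dyadic block `B_i`, `(n+1)^t ≤ 2^{|t|} · 2^{t i}` (both signs of `t`). [folklore] -/
theorem rpow_succ_le_on_block {i n : ℕ} (hn : n ∈ block i) (t : ℝ) :
    ((n : ℝ) + 1) ^ t ≤ (2 : ℝ) ^ |t| * (2 : ℝ) ^ (t * (i : ℝ)) := by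
  rw [block, Finset.mem_Ico] at hn
  obtain ⟨h1, h2⟩ := hn
  have h1' : (2 : ℝ) ^ (i : ℝ) ≤ (n : ℝ) + 1 := by
    rw [Real.rpow_natCast]
    have : ((2 ^ i : ℕ) : ℝ) ≤ (n : ℝ) := by exact_mod_cast h1
    push_cast at this
    linarith
  have h2' : (n : ℝ) + 1 ≤ (2 : ℝ) ^ ((i : ℝ) + 1) := by
    rw [Real.rpow_add (by norm_num), Real.rpow_natCast, Real.rpow_one]
    have : ((n + 1 : ℕ) : ℝ) ≤ ((2 ^ (i + 1) : ℕ) : ℝ) := by exact_mod_cast h2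
    push_cast at this
    rw [pow_succ] at this
    linarith
  have hn0 : (0 : ℝ) < (n : ℝ) + 1 := by positivity
  rcases le_or_gt 0 t with ht | ht
  · -- `t ≥ 0`: `(n+1)^t ≤ (2^(i+1))^t = 2^t · 2^(t i)`
    rw [abs_of_nonneg ht]
    calc ((n : ℝ) + 1) ^ t ≤ ((2 : ℝ) ^ ((i : ℝ) + 1)) ^ t := Real.rpow_le_rpow hn0.le h2' ht
      _ = (2 : ℝ) ^ t * (2 : ℝ) ^ (t * (i : ℝ)) := by
          rw [← Real.rpow_mul (by norm_num), ← Real.rpow_add (by norm_num)]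
          congr 1; ring
  · -- `t < 0`: `(n+1)^t ≤ (2^i)^t = 2^(t i) ≤ 2^|t| 2^(t i)`
    have hle : ((n : ℝ) + 1) ^ t ≤ ((2 : ℝ) ^ (i : ℝ)) ^ t :=
      Real.rpow_le_rpow_of_nonpos (by positivity) h1' ht.le
    have heq : ((2 : ℝ) ^ (i : ℝ)) ^ t = (2 : ℝ) ^ (t * (i : ℝ)) := by
      rw [← Real.rpow_mul (by norm_num)]; congr 1; ring
    have hge1 : (1 : ℝ) ≤ (2 : ℝ) ^ |t| := Real.one_le_rpow (by norm_num) (abs_nonneg t)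
    calc ((n : ℝ) + 1) ^ t ≤ (2 : ℝ) ^ (t * (i : ℝ)) := hle.trans_eq heq
      _ ≤ (2 : ℝ) ^ |t| * (2 : ℝ) ^ (t * (i : ℝ)) :=
          le_mul_of_one_le_left (Real.rpow_nonneg (by norm_num) _) hge1

/-- **Moment corollary of the block decay** (registered stub `tsum_rpow_cterm_ne_top_of_blockDecay`): if
`R'_i ≤ C_s 2^{s i}` for every `s > -1/2`, then `Σ_n (n+1)^t · cterm n < ∞` for every `t < 1/2`.
[cite: Hammond2015SAPJoining, Theorem 1.3 (averaged form)] -/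
theorem tsum_rpow_cterm_ne_top_of_blockDecay :
    (∀ s : ℝ, -(1 : ℝ) / 2 < s → ∃ C : ℝ, ∀ i : ℕ, blockMass jterm i ≤ C * (2 : ℝ) ^ (s * (i : ℝ))) →
      ∀ t : ℝ, t < 1 / 2 → ∑' n : ℕ, ENNReal.ofReal (((n : ℝ) + 1) ^ t * cterm n) ≠ ⊤ := by
  intro hdecay t ht
  -- choose the block exponent `s` strictly between `-1/2` and `-t`
  set s : ℝ := -t / 2 - 1 / 4 with hs
  have hs1 : -(1 : ℝ) / 2 < s := by rw [hs]; linarith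
  have hs2 : t + s < 0 := by rw [hs]; linarith
  obtain ⟨C, hC⟩ := hdecay s hs1
  have hC0 : 0 ≤ C := by
    have h0 := hC 0
    simp only [Nat.cast_zero, mul_zero, Real.rpow_zero, mul_one] at h0
    exact le_trans (blockMass_nonneg jterm_nonneg 0) h0
  set g : ℕ → ℝ := fun n => ((n : ℝ) + 1) ^ t * cterm n with hg
  have hg0 : ∀ n, 0 ≤ g n := fun n => mul_nonneg (Real.rpow_nonneg (by positivity) _) (cterm_nonneg n)
  -- block bound for `g`, `i ≥ 4`
  have hblock : ∀ i : ℕ, 4 ≤ i →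
      blockMass g i ≤ (2 : ℝ) ^ |t| * C * (1 + (2 : ℝ) ^ s) * (2 : ℝ) ^ ((t + s) * (i : ℝ)) := by
    intro i hi
    have h2s : 0 < (2 : ℝ) ^ (s * (i : ℝ)) := Real.rpow_pos_of_pos (by norm_num) _
    have h2t : 0 ≤ (2 : ℝ) ^ |t| * (2 : ℝ) ^ (t * (i : ℝ)) :=
      mul_nonneg (Real.rpow_nonneg (by norm_num) _) (Real.rpow_nonneg (by norm_num) _)
    calc blockMass g i = ∑ n ∈ block i, ((n : ℝ) + 1) ^ t * cterm n := rfl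
      _ ≤ ∑ n ∈ block i, (2 : ℝ) ^ |t| * (2 : ℝ) ^ (t * (i : ℝ)) * cterm n :=
          Finset.sum_le_sum fun n hn =>
            mul_le_mul_of_nonneg_right (rpow_succ_le_on_block hn t) (cterm_nonneg n)
      _ = (2 : ℝ) ^ |t| * (2 : ℝ) ^ (t * (i : ℝ)) * ∑ n ∈ block i, cterm n := by
          rw [Finset.mul_sum]
      _ ≤ (2 : ℝ) ^ |t| * (2 : ℝ) ^ (t * (i : ℝ)) * (blockMass jterm i + blockMass jterm (i + 1)) :=
          mul_le_mul_of_nonneg_left (sum_block_cterm_le hi) h2t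
      _ ≤ (2 : ℝ) ^ |t| * (2 : ℝ) ^ (t * (i : ℝ)) *
            (C * (2 : ℝ) ^ (s * (i : ℝ)) + C * (2 : ℝ) ^ (s * ((i + 1 : ℕ) : ℝ))) :=
          mul_le_mul_of_nonneg_left (add_le_add (hC i) (hC (i + 1))) h2t
      _ = (2 : ℝ) ^ |t| * C * (1 + (2 : ℝ) ^ s) * (2 : ℝ) ^ ((t + s) * (i : ℝ)) := by
          have e1 : (2 : ℝ) ^ (s * ((i + 1 : ℕ) : ℝ)) = (2 : ℝ) ^ (s * (i : ℝ)) * (2 : ℝ) ^ s := by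
            rw [← Real.rpow_add (by norm_num)]; congr 1; push_cast; ring
          have e2 : (2 : ℝ) ^ ((t + s) * (i : ℝ)) = (2 : ℝ) ^ (t * (i : ℝ)) * (2 : ℝ) ^ (s * (i : ℝ)) := by
            rw [← Real.rpow_add (by norm_num)]; congr 1; ring
          rw [e1, e2]; ring
  -- absorb the finitely many `i < 4`
  set K : ℝ := (2 : ℝ) ^ |t| * C * (1 + (2 : ℝ) ^ s) with hK
  have hK0 : 0 ≤ K := by rw [hK]; positivity
  set K' : ℝ := K + ∑ j ∈ Finset.range 4, blockMass g j * (2 : ℝ) ^ (-((t + s) * (j : ℝ))) with hK'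
  have hterm0 : ∀ j, 0 ≤ blockMass g j * (2 : ℝ) ^ (-((t + s) * (j : ℝ))) := fun j =>
    mul_nonneg (blockMass_nonneg hg0 j) (Real.rpow_nonneg (by norm_num) _)
  refine tsum_ofReal_ne_top_of_blockMass_le hg0 ⟨K', t + s, hs2, fun i => ?_⟩
  have hpow : 0 < (2 : ℝ) ^ ((t + s) * (i : ℝ)) := Real.rpow_pos_of_pos (by norm_num) _
  rcases le_or_gt 4 i with hi | hi
  · calc blockMass g i ≤ K * (2 : ℝ) ^ ((t + s) * (i : ℝ)) := hblock i hi
      _ ≤ K' * (2 : ℝ) ^ ((t + s) * (i : ℝ)) := by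
          apply mul_le_mul_of_nonneg_right _ hpow.le
          rw [hK']
          linarith [Finset.sum_nonneg fun j (_ : j ∈ Finset.range 4) => hterm0 j]
  · have hmem : i ∈ Finset.range 4 := Finset.mem_range.2 hi
    have hle : blockMass g i * (2 : ℝ) ^ (-((t + s) * (i : ℝ))) ≤ K' := by
      rw [hK']
      have := Finset.single_le_sum (fun j _ => hterm0 j) hmem
      linarith
    have hone : (2 : ℝ) ^ (-((t + s) * (i : ℝ))) * (2 : ℝ) ^ ((t + s) * (i : ℝ)) = 1 := by
      rw [← Real.rpow_add (by norm_num), neg_add_cancel, Real.rpow_zero]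
    calc blockMass g i = blockMass g i * ((2 : ℝ) ^ (-((t + s) * (i : ℝ))) * (2 : ℝ) ^ ((t + s) * (i : ℝ))) := by
          rw [hone, mul_one]
      _ = blockMass g i * (2 : ℝ) ^ (-((t + s) * (i : ℝ))) * (2 : ℝ) ^ ((t + s) * (i : ℝ)) := by ring
      _ ≤ K' * (2 : ℝ) ^ ((t + s) * (i : ℝ)) := mul_le_mul_of_nonneg_right hle hpow.le

end Summit.CriticalPhenomena.SAWScalingLimit.Theorems.CriticalBubbleBound.Join

end
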